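import Mathlib.NumberTheory.Padics.RingHoms
import Mathlib.Algebra.Polynomial.Monic
import HarnessLib

/-!
# R90-TF · S3 · THEOREMS — `R90S3PadicTargetReading` ((U3-F) split, B4 reading bridge): the `p^N`-target `T_p := H mod p^N` of a monic `H ∈ ℤ_p[X]` with
# `H(0) = p^a` is monic of the same degree with constant term `p^a` — the three hypotheses `(hTm, hTd, hT0)` of ★ `exists_planted_targetList`

R90-TF section S3 (dealer R90-C12-plan (g2)'s booking line 2026-09-05T01:24:25Z «`T_p := H.map (toZModPow N)` … `(p : ℤ_[p])^a ↦ (p^a : ZMod (p^N))` by `map_pow`»;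
offered as bridge (i) on the R90 bus 01:26Z); crux H413 (`stmt-HodgeConjecture-24833`, lane `--supports … --as helper`), route `HCCMUnconditional`.  Connects ★
`R90S3LocalTarget` (captain K2E3-p17: the local target `H`, monic over `ℤ_[p]` with `H.coeff 0 = p ^ a`) to ★ B4b-inst `R90S3PlantingTargetList` (abstract `T_p`).  THEOREMS
ONLY (no `def`, no `instance`, no notation, no named fact, no `sorry`); Mathlib imports only; never imports `Cruxes/…/Lines`.

THE MATHEMATICS [folklore; Neukirch1999 Ch. II (5.7) for `ℤ_p ∕ p^N = ℤ ∕ p^N`].  Reduction modulo `p^N` (Mathlib `PadicInt.toZModPow N : ℤ_[p] →+* ℤ∕p^N`) maps a monic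
polynomial to a monic polynomial of the same degree as soon as the target ring is non-trivial (`N ≥ 1`), and sends the constant term `p^a` to the residue of the
INTEGER `p^a` — the form in which ★ B4b-inst pins the constant term (`T_p.coeff 0 = ((c₀ : ℤ) : ZMod (p^N))`, `c₀ = p^a > 0`).
* `toZModPow_natCast_pow`, `monic_map_toZModPow`, `natDegree_map_toZModPow`, **`map_toZModPow_target`** (the triple `(Monic, natDegree = d, coeff 0 = (p^a : ℤ))` at once),
  `pow_pos_int_of_prime` (the positivity `0 < (p^a : ℤ)` ★ B4b-inst asks for).

HONEST LABEL: HC_CM is proved only modulo the 7 printed citations (2 remaining named inputs: hLiu418 = stmt-HodgeConjecture-24832, h413 =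
stmt-HodgeConjecture-24833) until rung 0 closes; glue toward the GENUINE residual (U3-F); proves nothing printed; count-neutral.

## References
* [Neukirch1999] J. Neukirch, *Algebraic Number Theory* (1999), Ch. II (5.7).
-/

set_option autoImplicit false
-- the mandated namespace repeats the single-problem summit's segment (`HodgeConjecture.HodgeConjecture`)
set_option linter.dupNamespace false

noncomputable section

namespace Summit.HodgeConjecture.HodgeConjecture.R90.S3

open Polynomial

variable {p : ℕ} [hp : Fact p.Prime]

/-- `toZModPow N` sends `(p : ℤ_[p])^a` to the residue of the integer `p^a`. [folklore] -/
theorem toZModPow_natCast_pow (N a : ℕ) : PadicInt.toZModPow N ((p : ℤ_[p]) ^ a) = (((p : ℤ) ^ a : ℤ) : ZMod (p ^ N)) := by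
  rw [map_pow, map_natCast]
  push_cast
  rfl

/-- The reduction of a monic `H ∈ ℤ_[p][X]` modulo `p^N` is monic. [folklore] -/
theorem monic_map_toZModPow (N : ℕ) {H : ℤ_[p][X]} (hH : H.Monic) : (H.map (PadicInt.toZModPow N)).Monic :=
  hH.map _

/-- The reduction of a monic `H ∈ ℤ_[p][X]` modulo `p^N`, `N ≥ 1`, has the same degree. [folklore] -/
theorem natDegree_map_toZModPow {N : ℕ} (hN : N ≠ 0) {H : ℤ_[p][X]} (hH : H.Monic) : (H.map (PadicInt.toZModPow N)).natDegree = H.natDegree := by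
  haveI : Fact (1 < p ^ N) := ⟨Nat.one_lt_pow hN hp.out.one_lt⟩
  exact hH.natDegree_map _

/-- **The `p^N`-target of ★ B4b-inst from the local target `H`.**  For a monic `H ∈ ℤ_[p][X]` of degree `d` with `H(0) = p^a` and `N ≥ 1`, the reduction
`T_p := H mod p^N` is monic of degree `d` with `T_p(0) = ((p^a : ℤ) : ℤ∕p^N)` — the hypotheses `(hTm, hTd, hT0)` of ★ `exists_planted_targetList` at `c₀ := p^a`.
[cite: Neukirch1999, Ch. II (5.7)] -/
theorem map_toZModPow_target {N : ℕ} (hN : N ≠ 0) {H : ℤ_[p][X]} (hH : H.Monic) {d : ℕ} (hHd : H.natDegree = d) {a : ℕ} (hH0 : H.coeff 0 = (p : ℤ_[p]) ^ a) :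
    (H.map (PadicInt.toZModPow N)).Monic ∧ (H.map (PadicInt.toZModPow N)).natDegree = d ∧
      (H.map (PadicInt.toZModPow N)).coeff 0 = (((p : ℤ) ^ a : ℤ) : ZMod (p ^ N)) := by
  refine ⟨monic_map_toZModPow N hH, by rw [natDegree_map_toZModPow hN hH, hHd], ?_⟩
  rw [coeff_map, hH0, toZModPow_natCast_pow]

omit hp in
/-- `0 < (p^a : ℤ)` for a prime (indeed any positive) `p` — the positivity of the pinned constant term ★ B4b-inst asks for. [folklore] -/
theorem pow_pos_int_of_prime (hp' : p.Prime) (a : ℕ) : (0 : ℤ) < (p : ℤ) ^ a :=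
  pow_pos (by exact_mod_cast hp'.pos) a

end Summit.HodgeConjecture.HodgeConjecture.R90.S3

end
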